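import Summits.ABC.IUTFork.Cor312LicenceWildInhabitedTriple
import Summits.ABC.IUTFork.Conditional.WRowFrey283Packages
import Literature.IUT.LogVolume.GenuineLogThetaPointDegrees
import Literature.IUT.LogVolume.Corollary22PartIIUpTo
import HarnessLib

/-!
# Branch C / R-W W1 «ROW DECISIONS», inhabited side — OPEN-10.md row 8: the abc triple `283 + 5¹¹·13² = 2⁸·3⁸·17³` at `l = 283`
# (`pilotDataOfK:frey-283-8251953125-8251953408:283`): S_H INHABITED modulo the four bad ramification indices BY NAME

PROOF-ONLY file (no `def`, no new `Prop`, no instance) of the abc-iut cell — D-0079 RESCUE sub-cell R-W «WINDOW Θ-SIDE INEQUALITY», W1 ROW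
DECISIONS (D-0107 «first WINDOW-row decision, inhabited side»), seat abc-iut-W-row-2 gen 0; row 8 of the numerics lead's
HOME/plan/rescue/R-W/OPEN-10.md (sha16 1b0025ee7a8ba6d7; table of record WINDOW-TABLE v4.2): the known abc triple
`(a, b, c) = (283, 5¹¹·13², 2⁸·3⁸·17³)` at `l = 283` (`l⋆ = 141`, Szpiro-bad margin −24.8 per the table; bad primes `{3, 5, 13, 17}` —
`283 = l` is excluded by [IUTchI] Def. 3.1 (c) and `2` by (b)). TAKES NO SIDE on [IUTchIII] Cor. 3.12 or on any author.

WHAT IS PROVED (namespace `Summit.ABC.IUTFork.Conditional`). Over abc-iut-W-row-1's socket (p470548 + `…GenuineK`), its triple package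
`WRowFrey283Packages` (`isABCTriple_frey283`) and this seat's abc-triple bridge (`Cor312LicenceWildInhabitedTriple`, p476012):
**`GenuineK.exists_qPinned_and_hull_chosen_triple_283_of_localType`** — for EVERY genuine Θ-volume datum `T` at `(ratPoint (283/c), 283)`
([IUTchIV] Cor. 2.2 (ii) (P7)), the CHOSEN realising ideles and every choice of the free context binders / columns: IF the absolute
ramification index of the completion `K_x` at every BAD fibre point `x | p` is the tabulated one — `e = 8490 = 30·l` over `3`, `16980 = 60·l`
over `5`, `4245 = 15·l` over `13`, `2830 = 10·l` over `17` (ONE binder `he`; the tree pins these one-sidedly: `e ∣ 60·l` at `13, 17`,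
abc-iut-W-neg-1 p459442; `30·l ∣ e` at `3`, `60·l ∣ e·11` at `5`, `15·l ∣ e·t`, abc-iut-W-neg-2 p467688 / `Cor312GenuineKCyclotomicLowerBound`) —
THEN branch C's per-datum antecedent «∃ ρ qK, QPinned ∧ PilotKummerCompatHull» HOLDS at abc-iut-c312-7's sharp setting
`settingPrVolSharp (pilotDataOfK T.D T.K) …`: the `hSHw`-shaped binder of the window certificates is DISCHARGED at this datum (modulo `he`).
Everything else is a theorem: conjugacy of the bad fibres (`d_mod = 1`), `P_p = e_p·v_p(abc)/l` (`= 240, 660, 30, 30`), the different bound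
`D_p = e_p − 1`, the inner radius `ρin = 1` (the unit ball is never inside `log_p(𝒪^×)`), the outer radius `ρout = p^{a₀} − e_p·a₀`
(`a₀ = 8, 6, 3, 2`: `−52403, −86255, −10538, −5371`) and the `4 × 141` integer cells, decided by `decide` (minimal margins `140178 / 190150 / 25351 /
13602` in units of `1/e_p`, cf. the table's `148428 / 224110 / 29596 / 16432` at the exact wild inputs).

HONEST SCOPE: OUR sharp containers and Dupuy–Hilado's typed (Ind1)/(Ind2); the hull licence is a STRONGER-THAN-PRINT reading of Step (xi-f);
NON-EMPTINESS of the datum type, admissibility (P1)–(P6) and Szpiro-badness of `(ratPoint (283/c), 283)` are NOT claimed; the local type `he` is a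
HYPOTHESIS (GAP-LEDGER G-Wnum2-1 at `p ∈ {3, 5}`); nothing about the printed GLOBAL inequality or the number-level corollary; «inhabited as typed» ≠
«true in print»; typed ≠ proved; instantiated ≠ endorsed. [cite: Mochizuki2012, IUTchI Def. 3.1 (b),(c) pp. 61–62; IUTchIII Cor. 3.12 Step (xi-d)
p. 183, (xi-f) p. 184; IUTchIV Cor. 2.2 (ii) proof p. 44–46] [cite: DupuyHilado2025, §3.3, §3.4, §4.9, §4.12] [claim: Mochizuki2012, status: disputed]
for every IUT sentence quoted.
-/

noncomputable section

open Set Function NumberField IsDedekindDomain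

namespace Summit.ABC.IUTFork.Conditional

open Thm311 Thm311.Real Cor312 Cor312Vol Cor312Prov Literature.IUT.LogThetaLattice Literature.IUT.LogVolume
  Literature.IUT.HodgeTheaters Literature.IUT.LogVolume.Cor22
open Literature.NumberTheory.NumberFields Literature.NumberTheory.GaloisRepresentations.Ultrametric
open Literature.NumberTheory.DiophantineGeometry Literature.NumberTheory.DiophantineGeometry.GenEll

/-- The prime divisors of `283 · (5¹¹·13²) · (2⁸·3⁸·17³)`. [folklore] -/
theorem eq_of_prime_dvd_triple_283 {p : ℕ} (hp : p.Prime) (h : p ∣ 283 * 8251953125 * 8251953408) :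
    p = 2 ∨ p = 3 ∨ p = 5 ∨ p = 13 ∨ p = 17 ∨ p = 283 := by
  have h' : p ∣ 283 * (5 ^ 11 * 13 ^ 2) * (2 ^ 8 * 3 ^ 8 * 17 ^ 3) := by norm_num; exact h
  rcases (Nat.Prime.dvd_mul hp).1 h' with h1 | h1
  · rcases (Nat.Prime.dvd_mul hp).1 h1 with h2 | h2
    · exact Or.inr (Or.inr (Or.inr (Or.inr (Or.inr ((Nat.prime_dvd_prime_iff_eq hp (by norm_num)).1 h2)))))
    · rcases (Nat.Prime.dvd_mul hp).1 h2 with h3 | h3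
      · exact Or.inr (Or.inr (Or.inl ((Nat.prime_dvd_prime_iff_eq hp (by norm_num)).1 (hp.dvd_of_dvd_pow h3))))
      · exact Or.inr (Or.inr (Or.inr (Or.inl ((Nat.prime_dvd_prime_iff_eq hp (by norm_num)).1 (hp.dvd_of_dvd_pow h3)))))
  · rcases (Nat.Prime.dvd_mul hp).1 h1 with h2 | h2
    · rcases (Nat.Prime.dvd_mul hp).1 h2 with h3 | h3
      · exact Or.inl ((Nat.prime_dvd_prime_iff_eq hp (by norm_num)).1 (hp.dvd_of_dvd_pow h3))
      · exact Or.inr (Or.inl ((Nat.prime_dvd_prime_iff_eq hp (by norm_num)).1 (hp.dvd_of_dvd_pow h3)))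
    · exact Or.inr (Or.inr (Or.inr (Or.inr (Or.inl ((Nat.prime_dvd_prime_iff_eq hp (by norm_num)).1 (hp.dvd_of_dvd_pow h2))))))

/-- `v_p(n) = k` from `n = p^k·m` with `p ∤ m`. [folklore] -/
private theorem factorization_eq_of_eq_pow_mul {p k m n : ℕ} (hp : p.Prime) (hn : n = p ^ k * m) (hm : ¬ p ∣ m) :
    n.factorization p = k := by
  subst hn
  have hm0 : m ≠ 0 := fun h => hm (h ▸ dvd_zero p)
  rw [Nat.factorization_mul (pow_ne_zero _ hp.ne_zero) hm0, Finsupp.add_apply, hp.factorization_pow, Finsupp.single_eq_same,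
    Nat.factorization_eq_zero_of_not_dvd hm, add_zero]

/-- `v₃(abc) = 8`, `v₅(abc) = 11`, `v₁₃(abc) = 2`, `v₁₇(abc) = 3` for the triple `283 + 5¹¹·13² = 2⁸·3⁸·17³`. [folklore] -/
theorem factorization_triple_283 :
    (283 * 8251953125 * 8251953408).factorization 3 = 8 ∧ (283 * 8251953125 * 8251953408).factorization 5 = 11 ∧
      (283 * 8251953125 * 8251953408).factorization 13 = 2 ∧ (283 * 8251953125 * 8251953408).factorization 17 = 3 :=
  ⟨factorization_eq_of_eq_pow_mul (m := 2937175637500000000) Nat.prime_three (by norm_num) (by norm_num),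
    factorization_eq_of_eq_pow_mul (m := 394666175644416) (by norm_num) (by norm_num) (by norm_num),
    factorization_eq_of_eq_pow_mul (m := 114028457737500000000) (by norm_num) (by norm_num) (by norm_num),
    factorization_eq_of_eq_pow_mul (m := 3922411837500000000) (by norm_num) (by norm_num) (by norm_num)⟩

set_option maxRecDepth 16384 in
/-- **OPEN-10 ROW 8 — S_H INHABITED at `283 + 5¹¹·13² = 2⁸·3⁸·17³`, `l = 283`, modulo the local ramification indices.** For every genuine
Θ-volume datum `T` at `(ratPoint (283/8251953408), 283)`, the CHOSEN realising ideles, every choice of the free context binders and columns: IF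
(`he`) every BAD fibre point `x | p` of the index of `pilotDataOfK T.D T.K` has `e(K_x/ℚ_p) = 8490` (`p = 3`), `16980` (`p = 5`), `4245` (`p = 13`),
`2830` (`p = 17`) — the bad primes are exactly these (`p ∣ abc`, `p ≠ 2`, `p ≠ l = 283`) — THEN branch C's per-datum antecedent
«∃ ρ qK, QPinned ∧ PilotKummerCompatHull» holds at `settingPrVolSharp (pilotDataOfK T.D T.K) …`. The `4 × 141` integer cells
`e·⌊(j²P − j(e−1) − (j+1))/e⌋ + (j+1)(p^{a₀} − e·a₀) ≤ P` (`(P, a₀) = (240, 8), (660, 6), (30, 3), (30, 2)`) are decided by `decide`.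
[cite: Mochizuki2012, IUTchIII Cor. 3.12 Step (xi-d) p. 183, (xi-f) p. 184; IUTchIV Cor. 2.2 (ii) proof p. 44–46] [cite: DupuyHilado2025, §3.3, §3.4, §4.9]
[claim: Mochizuki2012, status: disputed] -/
theorem GenuineK.exists_qPinned_and_hull_chosen_triple_283_of_localType
    (T : Cor22.ThetaVolumeDatumAt (ratPoint (((283 : ℕ) : ℚ) / (8251953408 : ℕ))) 283)
    (he : letI := T.instFieldF; letI := T.instNumberFieldF; letI := T.instAlgebraF; letI := T.instFieldK
      letI := T.instNumberFieldK; letI := T.instAlgebraK; letI := T.instFieldFbar; letI := T.instAlgebraFbar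
      letI := T.instAlgebraKFbar; letI := T.instIsElliptic
      ∀ (pp : Nat.Primes) (x : (thetaIndex (pilotDataOfK T.D T.K)).Fibre (.inr pp)), haveI : Fact (pp : ℕ).Prime := ⟨pp.2⟩
        placeOf (pilotDataOfK T.D T.K) pp.1 x ∈ (pilotDataOfK T.D T.K).S →
          absRamificationIdx (pp : ℕ) (kOf (pilotDataOfK T.D T.K) pp.1 x) =
            (if (pp : ℕ) = 3 then 8490 else if (pp : ℕ) = 5 then 16980 else if (pp : ℕ) = 13 then 4245 else 2830)) :
    letI := T.instFieldF; letI := T.instNumberFieldF; letI := T.instAlgebraF; letI := T.instFieldK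
    letI := T.instNumberFieldK; letI := T.instAlgebraK; letI := T.instFieldFbar; letI := T.instAlgebraFbar
    letI := T.instAlgebraKFbar; letI := T.instIsElliptic
    ∀ (M : Type) [Field M] [NumberField M]
      (archPk : ∀ (j : (thetaIndex (pilotDataOfK T.D T.K)).Label) (vQ : (thetaIndex (pilotDataOfK T.D T.K)).VQ),
        Set ((logShellsDH (pilotDataOfK T.D T.K) (analyticLogv T.K)).Packet j vQ))
      (archSub : ∀ (j : (thetaIndex (pilotDataOfK T.D T.K)).Label) (v : (thetaIndex (pilotDataOfK T.D T.K)).V),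
        Set ((logShellsDH (pilotDataOfK T.D T.K) (analyticLogv T.K)).Packet j ((thetaIndex (pilotDataOfK T.D T.K)).over v)))
      (Ψ : ℤ → ∀ v : (thetaIndex (pilotDataOfK T.D T.K)).V, v ∈ (thetaIndex (pilotDataOfK T.D T.K)).Vbad →
        Set ((logShellsDH (pilotDataOfK T.D T.K) (analyticLogv T.K)).StarPacket v))
      (act : ℤ → ∀ v : (thetaIndex (pilotDataOfK T.D T.K)).V, v ∈ (thetaIndex (pilotDataOfK T.D T.K)).Vbad →
        (logShellsDH (pilotDataOfK T.D T.K) (analyticLogv T.K)).StarPacket v →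
          Module.End ℚ ((logShellsDH (pilotDataOfK T.D T.K) (analyticLogv T.K)).StarPacket v))
      (Mmod : ℤ → ∀ j : (thetaIndex (pilotDataOfK T.D T.K)).LabelStar,
        Set ((logShellsDH (pilotDataOfK T.D T.K) (analyticLogv T.K)).GlobalPacket j.1))
      (region : ℤ → ∀ j : (thetaIndex (pilotDataOfK T.D T.K)).LabelStar, FinDivisor M → ∀ vQ : (thetaIndex (pilotDataOfK T.D T.K)).VQ,
        Set ((logShellsDH (pilotDataOfK T.D T.K) (analyticLogv T.K)).Packet j.1 vQ))
      (n : ℤ) {HT : Type} {LogLink : HT → HT → Type} {IsFull : ∀ {s t : HT}, LogLink s t → Prop}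
      (lat : LGPGaussianLogThetaLattice LogLink IsFull)
      {Frd : Type} {IsoF : Frd → Frd → Type} {Ob : Frd → Type} {realify : Frd → Frd} {Strip : Type}
      {IsoS : Strip → Strip → Type} {Mv : ∀ v : (thetaIndex (pilotDataOfK T.D T.K)).V, v ∈ (thetaIndex (pilotDataOfK T.D T.K)).Vbad → Type}
      [∀ v h, Monoid (Mv v h)]
      (sig : GlobalLGPFrobenioidSignature (thetaIndex (pilotDataOfK T.D T.K)).lstar (thetaIndex (pilotDataOfK T.D T.K)).V
        (· ∈ (thetaIndex (pilotDataOfK T.D T.K)).Vbad) Frd IsoF Ob realify Strip IsoS Mv)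
      (split : SplittingMonoids Mv) {ObΔ : Type}
      {N : ∀ v : (thetaIndex (pilotDataOfK T.D T.K)).V, v ∈ (thetaIndex (pilotDataOfK T.D T.K)).Vbad → Type}
      [∀ v h, Monoid (N v h)] (qData : QPilotData ObΔ N)
      (col : ℤ → Column (logShellsDH (pilotDataOfK T.D T.K) (analyticLogv T.K))),
      ∃ (ρ' : (∀ v : (thetaIndex (pilotDataOfK T.D T.K)).V, v ∈ (thetaIndex (pilotDataOfK T.D T.K)).Vbad →
            Set ((logShellsDH (pilotDataOfK T.D T.K) (analyticLogv T.K)).StarPacket v)) →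
          ∀ (j : (thetaIndex (pilotDataOfK T.D T.K)).Label) (vQ : (thetaIndex (pilotDataOfK T.D T.K)).VQ),
            Set ((logShellsDH (pilotDataOfK T.D T.K) (analyticLogv T.K)).Packet j vQ))
        (qK : ∀ v : (thetaIndex (pilotDataOfK T.D T.K)).V, v ∈ (thetaIndex (pilotDataOfK T.D T.K)).Vbad →
          Set ((logShellsDH (pilotDataOfK T.D T.K) (analyticLogv T.K)).StarPacket v)),
        QPinned ({ toSituation := (situationPrVol (pilotDataOfK T.D T.K) (logvAnalytic_analyticLogv (F := T.K)) M archPk archSub Ψ act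
              Mmod region), col := col } : LatticeSituation (thetaIndex (pilotDataOfK T.D T.K)))
          (settingPrVolSharp (pilotDataOfK T.D T.K) (logvAnalytic_analyticLogv (F := T.K)) M archPk archSub Ψ act Mmod region n lat
            sig split qData (exists_realising_qIdeles_pilotDataOfK T.D).choose (exists_realising_thetaIdeles_pilotDataOfK T.D).choose
            (exists_realising_qIdeles_pilotDataOfK T.D).choose_spec.1 (exists_realising_qIdeles_pilotDataOfK T.D).choose_spec.2.1) ρ' qK ∧
        PilotKummerCompatHull ({ toSituation := (situationPrVol (pilotDataOfK T.D T.K) (logvAnalytic_analyticLogv (F := T.K)) M archPk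
              archSub Ψ act Mmod region), col := col } : LatticeSituation (thetaIndex (pilotDataOfK T.D T.K)))
          (settingPrVolSharp (pilotDataOfK T.D T.K) (logvAnalytic_analyticLogv (F := T.K)) M archPk archSub Ψ act Mmod region n lat
            sig split qData (exists_realising_qIdeles_pilotDataOfK T.D).choose (exists_realising_thetaIdeles_pilotDataOfK T.D).choose
            (exists_realising_qIdeles_pilotDataOfK T.D).choose_spec.1 (exists_realising_qIdeles_pilotDataOfK T.D).choose_spec.2.1) ρ' qK := by
  letI := T.instFieldF; letI := T.instNumberFieldF; letI := T.instAlgebraF; letI := T.instFieldK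
  letI := T.instNumberFieldK; letI := T.instAlgebraK; letI := T.instFieldFbar; letI := T.instAlgebraFbar
  letI := T.instAlgebraKFbar; letI := T.instIsElliptic
  intro M _ _ archPk archSub Ψ act Mmod region n HT LogLink IsFull lat Frd IsoF Ob realify Strip IsoS Mv _ sig split ObΔ N _ qData col
  have hF : Module.finrank ℚ (fieldOfModuli T.E) = 1 :=
    T.finrank_rat_fieldOfModuli_eq_dmod.trans (dmod_eq_one_of_degree_le_one (by rw [degree_ratPoint]))
  have hj : T.E.j = ((Cor22.jInv (((283 : ℕ) : ℚ) / (8251953408 : ℕ)) : ℚ) : T.F) := by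
    rw [T.j_eq]; exact eq_ratCast _ _
  have hl : (pilotDataOfK T.D T.K).lstar = 141 := by simp only [PilotData.lstar, pilotDataOfK_l]
  obtain ⟨hf3, hf5, hf13, hf17⟩ := factorization_triple_283
  refine exists_qPinned_and_hull_settingPrVolSharp_pilotDataOfK_triple T.D (logvAnalytic_analyticLogv (F := T.K)) M archPk archSub Ψ
    act Mmod region n lat sig split qData (exists_realising_qIdeles_pilotDataOfK T.D).choose
    (exists_realising_thetaIdeles_pilotDataOfK T.D).choose (exists_realising_qIdeles_pilotDataOfK T.D).choose_spec.1
    (exists_realising_qIdeles_pilotDataOfK T.D).choose_spec.2.1 col (exists_realising_thetaIdeles_pilotDataOfK T.D).choose_spec.1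
    (exists_realising_thetaIdeles_pilotDataOfK T.D).choose_spec.2.2 (exists_realising_qIdeles_pilotDataOfK T.D).choose_spec.2.2
    isABCTriple_frey283 hj hF
    (fun pp => if (pp : ℕ) = 3 then 8490 else if (pp : ℕ) = 5 then 16980 else if (pp : ℕ) = 13 then 4245 else 2830)
    (fun pp => (if (pp : ℕ) = 3 then 8490 else if (pp : ℕ) = 5 then 16980 else if (pp : ℕ) = 13 then 4245 else 2830) - 1)
    (fun pp => if (pp : ℕ) = 3 then 8 else if (pp : ℕ) = 5 then 6 else if (pp : ℕ) = 13 then 3 else 2)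
    (fun pp x hx => ?_) (fun pp hdvd h2 hl' => ?_)
  · -- the local inputs: `e` BY NAME, `D = e − 1` for free
    haveI : Fact (pp : ℕ).Prime := ⟨pp.2⟩
    exact ⟨he pp x hx, pred_div_le_differentOrd_of_eq (pp : ℕ) (he pp x hx)⟩
  · -- the arithmetic of the row at the four bad primes
    rw [hl]
    rcases eq_of_prime_dvd_triple_283 pp.2 hdvd with h | h | h | h | h | h
    · exact absurd h h2
    · simp only [h, hf3, if_true, if_false, Nat.reduceEqDiff]; decide
    · simp only [h, hf5, if_true, if_false, Nat.reduceEqDiff]; decide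
    · simp only [h, hf13, if_true, if_false, Nat.reduceEqDiff]; decide
    · simp only [h, hf17, if_false, Nat.reduceEqDiff]; decide
    · exact absurd h hl'

end Summit.ABC.IUTFork.Conditional

end
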